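import Summits.MatrixMultiplication.OmegaCensus.STPPCell22Sound1
import Summits.MatrixMultiplication.OmegaCensus.STPPCell22Sound2

/-!
# ω-census (abelian STPP census): cell-(2,2) certificate soundness, part 3 — the stage-1 test `place22` cannot miss a placement (tool file)

HONEST FRAMING (pub-omega census; verbatim): lottery ticket; floor = certified bounds/negative ranges.
Census STRUCTURE (seat pub-omega-stpp-1 gen 33, 2026-08-29), family (b2).  Mask-level soundness of stage 1 of the cell-(2,2) certificate
(`STPPCell22Checker.lean`; plan HOME `pub-omega-stpp-1-g33/FIFTH-LEAF.md` §SOUNDNESS step S7): the closure pre-filters pass on any sumset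
`W = Z + {0, q₁, q₂}` (`closure_test_eq`), a translate disjoint from `σ₁` is admissible (`mem_admissible_of_disjoint`), and `place22 … = true` then
forces the placement tuple into `plc` (`mem_plc_of_place22`).  UNCONDITIONAL; no `decide`.  Nothing here is progress on `ω`.

References: H. S. Warren, Hacker's Delight (2002), §2-1 (bit sets); H. Cohn, R. Kleinberg, B. Szegedy, C. Umans, FOCS 2005, Def. 5.1 (the use).
-/

namespace Summit.MatrixMultiplication.OmegaCensus.CubeNB.S2

open Summit.MatrixMultiplication.OmegaCensus.CubeNB.Bits

/-! ## §1 The closure pre-filters -/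

/-- Index arithmetic: `((i − q) mod p + q) mod p = i`. [folklore] -/
theorem mod_sub_add_cancel {p i q : ℕ} (hi : i < p) (hq : q ≤ p) : ((i + p - q) % p + q) % p = i := by
  rcases Nat.lt_or_ge i q with h | h
  · rw [Nat.mod_eq_of_lt (show i + p - q < p by omega), show i + p - q + q = i + p by omega, Nat.add_mod_right, Nat.mod_eq_of_lt hi]
  · rw [show i + p - q = i - q + p by omega, Nat.add_mod_right, Nat.mod_eq_of_lt (show i - q < p by omega), show i - q + q = i by omega,
      Nat.mod_eq_of_lt hi]

/-- **The closure test is exact on sumsets.**  If `W ⊆ [0,p)` is a sumset `Z + {0, q₁, q₂}` (membership form: `v ∈ W ↔ v = (z + q) mod p` with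
`z` satisfying `PZ` and `q ∈ [0, q₁, q₂]`), then `V + {0,q₁,q₂} = W` for `V = W ∩ (W − q₁) ∩ (W − q₂)`, as the checker computes it. [folklore] -/
theorem closure_test_eq {p W q₁ q₂ : ℕ} (hp : 0 < p) (hW : W < 2 ^ p) (hq₁ : q₁ < p) (hq₂ : q₂ < p) {PZ : ℕ → Prop}
    (hmem : ∀ v, tb W v = true ↔ v < p ∧ ∃ z, z < p ∧ PZ z ∧ ∃ q ∈ [0, q₁, q₂], (z + q) % p = v) :
    (W &&& rot p W (p - q₁) &&& rot p W (p - q₂)) ||| rot p (W &&& rot p W (p - q₁) &&& rot p W (p - q₂)) q₁ |||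
        rot p (W &&& rot p W (p - q₁) &&& rot p W (p - q₂)) q₂ = W := by
  set V := W &&& rot p W (p - q₁) &&& rot p W (p - q₂) with hV
  have hVlt : V < 2 ^ p := lt_of_le_of_lt (Nat.and_le_left.trans Nat.and_le_left) hW
  -- membership in `V`: `j`, `j + q₁`, `j + q₂` all lie in `W`
  have htbV : ∀ j, j < p → (tb V j = true ↔ tb W j = true ∧ tb W ((j + q₁) % p) = true ∧ tb W ((j + q₂) % p) = true) := by
    intro j hj
    rw [hV, tb_land, tb_land, Bool.and_eq_true, Bool.and_eq_true, tb_rot hW (Nat.sub_le _ _) hj, tb_rot hW (Nat.sub_le _ _) hj,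
      show j + p - (p - q₁) = j + q₁ by omega, show j + p - (p - q₂) = j + q₂ by omega, and_assoc]
  have hlt : (V ||| rot p V q₁ ||| rot p V q₂) < 2 ^ p := Nat.or_lt_two_pow (Nat.or_lt_two_pow hVlt (rot_lt_two_pow _ _ _)) (rot_lt_two_pow _ _ _)
  refine eq_of_tb_eq hlt hW fun i hi => ?_
  rw [Bool.eq_iff_iff, tb_lor, tb_lor, Bool.or_eq_true, Bool.or_eq_true, tb_rot hVlt hq₁.le hi, tb_rot hVlt hq₂.le hi]
  constructor
  · -- `V + q ⊆ W`
    rintro ((h | h) | h)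
    · exact ((htbV i hi).1 h).1
    · have h' := ((htbV _ (Nat.mod_lt _ hp)).1 h).2.1
      rwa [mod_sub_add_cancel hi hq₁.le] at h'
    · have h' := ((htbV _ (Nat.mod_lt _ hp)).1 h).2.2
      rwa [mod_sub_add_cancel hi hq₂.le] at h'
  · -- `W ⊆ V + q`: write `i = z + q`; then `z ∈ V`
    intro h
    obtain ⟨-, z, hz, hPz, q, hq, rfl⟩ := (hmem i).1 h
    have hzV : tb V z = true := by
      refine (htbV z hz).2 ⟨?_, ?_, ?_⟩
      · have := (hmem z).2 ⟨hz, z, hz, hPz, 0, by simp, by rw [Nat.add_zero, Nat.mod_eq_of_lt hz]⟩; exact this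
      · exact (hmem _).2 ⟨Nat.mod_lt _ hp, z, hz, hPz, q₁, by simp, rfl⟩
      · exact (hmem _).2 ⟨Nat.mod_lt _ hp, z, hz, hPz, q₂, by simp, rfl⟩
    simp only [List.mem_cons, List.not_mem_nil, or_false] at hq
    rcases hq with rfl | rfl | rfl
    · left; left; rwa [Nat.add_zero, Nat.mod_eq_of_lt hz]
    · left; right; rwa [mod_add_sub_cancel hz hq₁.le]
    · right; rwa [mod_add_sub_cancel hz hq₂.le]

/-! ## §2 Admissible translates -/

/-- **A translate disjoint from `σ₁` is admissible**: if no member `t` of `T0` has `t + s ∈ σ₁`, then `s` is a member of the complement of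
`D = ⋃_{t ∈ T0} (σ₁ − t)` and `D` is not full. [folklore] -/
theorem mem_admissible_of_disjoint {p σ₁ T0 s : ℕ} (hσ : σ₁ < 2 ^ p) (hs : s < p)
    (hdisj : ∀ t, t < p → tb T0 t = true → tb σ₁ ((s + t) % p) = false) :
    s ∈ members (List.range p) (fullMask p ^^^ (members (List.range p) T0).foldl (fun acc t => acc ||| rot p σ₁ (p - t)) 0) ∧
      Nat.beq ((members (List.range p) T0).foldl (fun acc t => acc ||| rot p σ₁ (p - t)) 0) (fullMask p) = false := by
  set D := (members (List.range p) T0).foldl (fun acc t => acc ||| rot p σ₁ (p - t)) 0 with hD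
  have hDs : tb D s = false := by
    rw [Bool.eq_false_iff]
    intro h
    rw [hD, tb_foldl_lor_fun] at h
    rcases h with h | ⟨t, ht, h⟩
    · rw [tb_zero] at h; exact Bool.false_ne_true h
    · obtain ⟨htr, htt⟩ := mem_members.1 ht
      have htp := List.mem_range.1 htr
      rw [tb_rot hσ (Nat.sub_le _ _) hs, show s + p - (p - t) = s + t by omega, hdisj t htp htt] at h
      exact Bool.false_ne_true h
  refine ⟨mem_members.2 ⟨List.mem_range.2 hs, by rw [tb_compl hs, hDs]; rfl⟩, ?_⟩
  rw [Bool.eq_false_iff]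
  intro h
  have hfull := Nat.eq_of_beq_eq_true h
  have : tb D s = true := by rw [hfull, tb_fullMask, decide_eq_true hs]
  rw [hDs] at this
  exact Bool.false_ne_true this

/-! ## §3 `place22` elimination -/

/-- **Stage 1 cannot miss a placement.**  If `place22 … = true`, `s` is admissible, both closure tests pass at `s` and the exact-cover test
succeeds, then the tuple `(y, σ₁, y′, σ₂, w, s)` is in `plc`. [folklore] -/
theorem mem_plc_of_place22 {p : ℕ} {plc : List (ℕ × ℕ × ℕ × ℕ × ℕ × ℕ)} {y σ₁ y' σ₂ w T0 : ℕ} {mT0 : List ℕ} {s : ℕ}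
    (h : place22 p plc y σ₁ y' σ₂ w T0 mT0 = true)
    (hadm : s ∈ members (List.range p) (fullMask p ^^^ mT0.foldl (fun acc t => acc ||| rot p σ₁ (p - t)) 0))
    (hnotfull : Nat.beq (mT0.foldl (fun acc t => acc ||| rot p σ₁ (p - t)) 0) (fullMask p) = false)
    (hQ : let W := fullMask p ^^^ (σ₁ ||| rot p T0 s)
      let V := W &&& rot p W (p - w % p) &&& rot p W (p - w * y' % p)
      Nat.beq (V ||| rot p V (w % p) ||| rot p V (w * y' % p)) W = true)
    (hP : let W := fullMask p ^^^ (σ₁ ||| rot p T0 s)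
      let U := W &&& rot p W (p - 1) &&& rot p W (p - y)
      Nat.beq (U ||| rot p U 1 ||| rot p U y) W = true)
    (hK : coverK p (xMask p y w y') (members (List.range p) (xMask p y w y')) 3 (fullMask p ^^^ (σ₁ ||| rot p T0 s)) = true) :
    (y, σ₁, y', σ₂, w, s) ∈ plc := by
  unfold place22 at h
  simp only [hnotfull, Bool.false_or, List.all_eq_true] at h
  have hs := h s hadm
  simp only [hQ, hP, hK, Bool.not_true, Bool.false_or, decide_eq_true_eq] at hs
  exact hs

end Summit.MatrixMultiplication.OmegaCensus.CubeNB.S2
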